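import Summits.BirchSwinnertonDyer.BirchSwinnertonDyer.Theorems.GenusKolyvaginAtTwoPowDvdShaCardAtTwoRTHalfTransverseIsotropicPackaged
import Summits.BirchSwinnertonDyer.BirchSwinnertonDyer.Theorems.GenusKolyvaginAtTwoEquivariantKolyvaginExactAtTwoKolyvaginPrimeDictionary
import Summits.BirchSwinnertonDyer.BirchSwinnertonDyer.Theorems.GenusKolyvaginAtTwoEquivariantKolyvaginExactAtTwoSelmerConditionVisible
import HarnessLib

/-!
# Route `GenusKolyvaginAtTwo`, crux L_T `PowDvdShaCardAtTwoRT` (stmt-BirchSwinnertonDyer-23242), LINE 18 stub L, bottom rung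
# (index-`≥ 2` engine): THE (iii)-SOCKET — a class is HALF-TRANSVERSE at an own prime as soon as its value at `F²` is a multiple of a
# TAME value (or its restriction over `K` has its Frobenius value in the line of an inertial value)

Seat `bsd-line-gk2-p3` g21 (PROVER seat 3/3, cell `bsd-f1-sign2`), `--supports 23242 --as helper`.  THEOREMS ONLY; no `sorry`.
BSD is NOT proved by any of this; neither is the crux nor stub L.

WHY (LEAD memo `Lines/plus-descent-lead-g16.md` §8; partition 06:36Z: gk2-p3 = input side (iii)).  The index-`≥ 2` bottom-rung engine
pairs `X = 2·Z`, `Z = desc c₂(nℓ′) ∈ H¹(ℚ, E^ε[4])`, with an auxiliary `y`; at a DEEP own prime `ℓ ∈ t` the term `⟨X_ℓ, y_ℓ⟩` vanishes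
(`…HalfTransverseLocalPackaged` / gk2-p4 `…RTDeepOwnPrimeCondition`, ht-form) as soon as **`Z` is HALF-TRANSVERSE at `ℓ`**
(`[Z, F] ∈ (F−1)T + 2T`; equivalently at level `4`: `2•Z` transverse).  This is input (iii).  Its SOURCE is the structure of Kolyvagin's
cocycle at an own prime: restricted to the decomposition group over `K` it takes all its values in the line `ℤ·[c, τ₁]` of its value at an
INERTIAL generator `τ₁` (this lineage's `…RTKolyvaginValuesLine.exists_h1Eval_kolyvaginClass_eq_zsmul`, displayed inputs `hcyc`/`hQ` =
McCallum Prop. 4.4 (1) at `2`: for an own prime of index `≥ M+1`, i.e. every DEEP prime).  This file is the SOCKET turning that shape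
into half-transversality, in the `h1Eval` currency of I7 / I7½:
* §1 `halfTransverse_of_h1Eval_sq_smul_eq_neg` — `[x, F²]` ANTI-INVARIANT under `F` ⟹ `x` half-transverse at `F` (`M ≥ 2`; the
  anti-invariants are the line `ℤ(P − FP)`, then `halfTransverse_of_h1Eval_sq_mem_line`);
  **`halfTransverse_of_h1Eval_sq_eq_zsmul_tame`** — `[x, F²] = k·[x, σ]` for a TAME value (`σ ∈ I_𝔓`) ⟹ half-transverse (tame values
  are anti-invariant: `smul_h1Eval_eq_neg_of_mem_inertia`).
* §2 `h1Eval_resGal_eq_zsmul_of_resTorsion` — transport `K → ℚ` of a line relation: `[res x, g]_K = k·[res x, σ]_K` ⟹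
  `[x, res g] = k·[x, res σ]` (`h1Eval_resTorsion_eq`, `torsionBaseChangeMap_injective`).
* §3 **`halfTransverse_of_resTorsion_values`** — `x ∈ H¹(ℚ, E[2^M])`, `K` a number field, `g₂, σ₁ ∈ Γ_{K(E_K[2^M])}` with
  `res g₂ = F²` and `res σ₁ ∈ I_𝔓`, and `[res x, g₂]_K ∈ ℤ·[res x, σ₁]_K` (the OUTPUT of `exists_h1Eval_kolyvaginClass_eq_zsmul` for
  `res x = c_M(m)`, `τ := g₂ ∈ D_λ`, `τ₁ := σ₁`) ⟹ `x` half-transverse at `F`; and the `∀𝔓 ∀F ∀c₀` packaging on `Δ < 0`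
  (`halfTransverse_forall_of_resTorsion_values`), the exact hypothesis shape of `…HalfTransverseIsotropicPackaged` /
  `…RTDeepOwnPrimeCondition.exists_localCondition_eight_le_forall` (via `transverse_nsmul_of_halfTransverse`).
* §4 (appended) `halfTransverse_of_resTorsion_values_of_eq_mul_inertia` — the same with `res g₂ = F²·i`, `i ∈ I_𝔓` (any Frobenius lift
  over `K`).
HONEST FLAG: the residual inputs (`hcyc`: `D_λ` acts on `P_m` through `⟨σ_ℓ⟩`; `hQ`: `P_m ∈ 2^M E(K_{m,λ_m})`, the «`ℓ(ℓ+1)/2`» bit,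
index `≥ M+1`) are McCallum Prop. 4.4 (1)-grade; the route's Q2 `KolyvaginRelationAtTwo` AS TYPED (two order clauses) yields only
`ord(unramified part) ≤ ord(transverse part)` at an own prime, not (iii).  Closes nothing.  BSD is NOT proved by any of this.

References: [McCallumLMS1991] §4 Prop. 4.4 (1) and proof (p. 305), §5 proof of Prop. 5.2; [GrossLMS1991] §3 (3.3), Prop. 6.2;
[SerreGaloisCohomology1997] I §2.4.
-/

set_option autoImplicit false
set_option linter.dupNamespace false -- tree convention: `Summit.BirchSwinnertonDyer.BirchSwinnertonDyer.Theorems` (summit = sub-problem)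

noncomputable section
open scoped Classical Pointwise
universe u

namespace Summit.BirchSwinnertonDyer.BirchSwinnertonDyer.Theorems.GenusExact.TransverseIsotropy

open WeierstrassCurve NumberField IsDedekindDomain Field
open Literature.NumberTheory.EllipticCurves Literature.NumberTheory.GaloisRepresentations
open Literature.NumberTheory.GaloisCohomology
open Summit.BirchSwinnertonDyer.BirchSwinnertonDyer.Theorems.GenusExact.FrobeniusCriterion
open Summit.BirchSwinnertonDyer.BirchSwinnertonDyer.Theorems.GenusExact.SelmerDescent

/-! ## §1 Half-transversality from an anti-invariant value at `F²` -/

section Algebra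

variable {K : Type u} [Field K] (W : WeierstrassCurve K) {n : ℤ} {F : absoluteGaloisGroup K} {M : ℕ}
  {P : geomTorsion W n}

/-- **`[x, F²]` anti-invariant ⟹ `x` half-transverse** (`M ≥ 2`, `T = E[n]` free of rank one over `ℤ/2^M[F]` on `P`): the anti-invariants
of a regular involution form the line `ℤ(P − FP) ⊆ (F−1)T` (`exists_eq_zsmul_sub_of_smul_eq_neg`), so `[x, F²] ∈ (F−1)T`, and
`halfTransverse_of_h1Eval_sq_mem_line` applies. [cite: McCallumLMS1991, §4 Prop. 4.4 (1)] -/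
theorem halfTransverse_of_h1Eval_sq_smul_eq_neg (hM : 2 ≤ M) (hF : ∀ Q : geomTorsion W n, F • F • Q = Q)
    (hPM : (2 : ℤ) ^ M • P = 0) (hgen : ∀ Q : geomTorsion W n, ∃ x y : ℤ, Q = x • P + y • F • P)
    (hfree : ∀ x y : ℤ, x • P + y • F • P = 0 → (2 : ℤ) ^ M ∣ x ∧ (2 : ℤ) ^ M ∣ y)
    {x : galH1Torsion W n} (hanti : F • h1Eval W n x (F * F) = -h1Eval W n x (F * F)) :
    ∃ P₁ Q₁ : geomTorsion W n, h1Eval W n x F = (F • P₁ - P₁) + (2 : ℕ) • Q₁ := by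
  obtain ⟨k, hk⟩ := exists_eq_zsmul_sub_of_smul_eq_neg W hF hPM hgen hfree hanti
  refine halfTransverse_of_h1Eval_sq_mem_line W hM hPM hgen hfree hF ⟨-(k • P), ?_⟩
  rw [hk, smul_sub, smul_neg, smul_comm F k P]
  abel

/-- **`[x, F²] ∈ ℤ·t` with `t` anti-invariant ⟹ `x` half-transverse** (same setting). [folklore] -/
theorem halfTransverse_of_h1Eval_sq_eq_zsmul_of_smul_eq_neg (hM : 2 ≤ M) (hF : ∀ Q : geomTorsion W n, F • F • Q = Q)
    (hPM : (2 : ℤ) ^ M • P = 0) (hgen : ∀ Q : geomTorsion W n, ∃ x y : ℤ, Q = x • P + y • F • P)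
    (hfree : ∀ x y : ℤ, x • P + y • F • P = 0 → (2 : ℤ) ^ M ∣ x ∧ (2 : ℤ) ^ M ∣ y)
    {x : galH1Torsion W n} {t : geomTorsion W n} (ht : F • t = -t) (hk : ∃ k : ℤ, h1Eval W n x (F * F) = k • t) :
    ∃ P₁ Q₁ : geomTorsion W n, h1Eval W n x F = (F • P₁ - P₁) + (2 : ℕ) • Q₁ := by
  obtain ⟨k, hk⟩ := hk
  refine halfTransverse_of_h1Eval_sq_smul_eq_neg W hM hF hPM hgen hfree ?_
  rw [hk, smul_comm F k t, ht, smul_neg]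

end Algebra

section Tame

variable {v : HeightOneSpectrum (𝓞 ℚ)} (W : WeierstrassCurve ℚ) [W.IsElliptic]

/-- **`[x, F²] = k·[x, σ]` for a TAME value ⟹ `x` half-transverse at `F`.**  Setting of I7 / I7½ (`q = 2^M`, `M ≥ 2`, prime to `v`;
`𝔓` the prime of the chosen embedding; `F` an arithmetic Frobenius at `𝔓` inverting `μ_q`, a regular involution on `T = E[q]`; `I_𝔓`
fixing `T`); `σ ∈ I_𝔓`.  Tame values are anti-invariant (`smul_h1Eval_eq_neg_of_mem_inertia`), so §1 applies.  This is the shape in which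
(iii) arrives from the own-prime structure of a Kolyvagin class: its value at the Frobenius of `K_λ` (`= F²`, `λ ∣ ℓ` inert) is a multiple
of its value at the inertial generator `τ₁` (`…RTKolyvaginValuesLine`). [cite: McCallumLMS1991, §4 Prop. 4.4 (1) and proof] [cite: GrossLMS1991, §3 (3.3)] -/
theorem halfTransverse_of_h1Eval_sq_eq_zsmul_tame {M q : ℕ} (hM : 2 ≤ M) (hq : q = 2 ^ M)
    (hqv : (q : 𝓞 ℚ) ∉ v.asIdeal)
    {𝔐 : Ideal (HeightOneSpectrum.localAbsIntegers v)} (h𝔐 : 𝔐 ∈ v.localPrimesAbove)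
    {F : absoluteGaloisGroup ℚ}
    (hFrob : IsArithFrobAt (𝓞 ℚ) F (v.primeBelow (closureEmb (K := ℚ) (v.adicCompletion ℚ)) 𝔐))
    (hFμ : ∀ ζ : AlgebraicClosure ℚ, ζ ^ q = 1 → F • ζ = ζ⁻¹)
    (hF : ∀ Q : geomTorsion W (q : ℤ), F • F • Q = Q)
    {P : geomTorsion W (q : ℤ)} (hPM : (2 : ℤ) ^ M • P = 0)
    (hgen : ∀ Q : geomTorsion W (q : ℤ), ∃ x y : ℤ, Q = x • P + y • F • P)
    (hfree : ∀ x y : ℤ, x • P + y • F • P = 0 → (2 : ℤ) ^ M ∣ x ∧ (2 : ℤ) ^ M ∣ y)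
    (hI : (v.primeBelow (closureEmb (K := ℚ) (v.adicCompletion ℚ)) 𝔐).inertia (absoluteGaloisGroup ℚ) ≤
      torsionFixing W (q : ℤ))
    {x : galH1Torsion W (q : ℤ)} {σ : absoluteGaloisGroup ℚ}
    (hσ : σ ∈ (v.primeBelow (closureEmb (K := ℚ) (v.adicCompletion ℚ)) 𝔐).inertia (absoluteGaloisGroup ℚ))
    (hk : ∃ k : ℤ, h1Eval W (q : ℤ) x (F * F) = k • h1Eval W (q : ℤ) x σ) :
    ∃ P₁ Q₁ : geomTorsion W (q : ℤ), h1Eval W (q : ℤ) x F = (F • P₁ - P₁) + (2 : ℕ) • Q₁ := by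
  set 𝔓 := v.primeBelow (closureEmb (K := ℚ) (v.adicCompletion ℚ)) 𝔐 with h𝔓def
  have h𝔓 : 𝔓 ∈ v.primesAbove := HeightOneSpectrum.primeBelow_mem_primesAbove h𝔐
  haveI : 𝔓.IsPrime := h𝔓.1
  have hF𝔓 : F • 𝔓 = 𝔓 := MulAction.mem_stabilizer_iff.mp hFrob.mem_stabilizer
  have ht : F • h1Eval W (q : ℤ) x σ = -h1Eval W (q : ℤ) x σ :=
    smul_h1Eval_eq_neg_of_mem_inertia W Nat.prime_two hq hqv h𝔓 hF𝔓 hFμ hI x hσ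
  have hPM' : ((2 : ℤ) ^ M) • P = 0 := hPM
  exact halfTransverse_of_h1Eval_sq_eq_zsmul_of_smul_eq_neg W hM hF hPM' hgen hfree ht hk

end Tame

/-! ## §2 Transport `K → ℚ` of a line relation between values -/

section Transport

variable (W : WeierstrassCurve ℚ) [W.IsElliptic] (K : Type) [Field K] [NumberField K] (n : ℤ)

omit [W.IsElliptic] in
/-- **`[res x, g]_K = k·[res x, σ]_K ⟹ [x, res g] = k·[x, res σ]`** for `g, σ ∈ Γ_{K(E_K[n])}`: the chosen cocycle of `res x` and the
pull-back of the chosen cocycle of `x` agree at elements fixing `E_K[n]` (`h1Eval_resTorsion_eq`), and the points map `θ` is injective.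
[cite: SerreGaloisCohomology1997, I §2.4] -/
theorem h1Eval_resGal_eq_zsmul_of_resTorsion (x : galH1Torsion W n) {g σ : absoluteGaloisGroup K}
    (hg : g ∈ torsionFixing (W.baseChange K) n) (hσ : σ ∈ torsionFixing (W.baseChange K) n) {k : ℤ}
    (h : h1Eval (W.baseChange K) n (resTorsion W K n x) g = k • h1Eval (W.baseChange K) n (resTorsion W K n x) σ) :
    h1Eval W n x (resGal (K := ℚ) K g) = k • h1Eval W n x (resGal (K := ℚ) K σ) := by
  haveI : Algebra.IsAlgebraic ℚ K := Algebra.IsAlgebraic.of_finite ℚ K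
  rw [h1Eval_resTorsion_eq W K n x hg, h1Eval_resTorsion_eq W K n x hσ, ← map_zsmul] at h
  exact torsionBaseChangeMap_injective W K n h

omit [W.IsElliptic] in
/-- The same with the line relation in `∃`-form («the value at `g` lies in `ℤ·`(value at `σ`)»). [folklore] -/
theorem exists_h1Eval_resGal_eq_zsmul_of_resTorsion (x : galH1Torsion W n) {g σ : absoluteGaloisGroup K}
    (hg : g ∈ torsionFixing (W.baseChange K) n) (hσ : σ ∈ torsionFixing (W.baseChange K) n)
    (h : ∃ k : ℤ, h1Eval (W.baseChange K) n (resTorsion W K n x) g = k • h1Eval (W.baseChange K) n (resTorsion W K n x) σ) :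
    ∃ k : ℤ, h1Eval W n x (resGal (K := ℚ) K g) = k • h1Eval W n x (resGal (K := ℚ) K σ) := by
  obtain ⟨k, hk⟩ := h
  exact ⟨k, h1Eval_resGal_eq_zsmul_of_resTorsion W K n x hg hσ hk⟩

end Transport

/-! ## §3 The (iii)-socket: half-transversality over `ℚ` from the own-prime line structure over `K` -/

section Socket

variable {v : HeightOneSpectrum (𝓞 ℚ)} (W : WeierstrassCurve ℚ) [W.IsElliptic] (K : Type) [Field K] [NumberField K]

/-- **(iii)-SOCKET.**  Setting of `halfTransverse_of_h1Eval_sq_eq_zsmul_tame` (`q = 2^M`, `M ≥ 2`, `F` a regular involutive Frobenius at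
the prime `𝔓` of the chosen embedding, inverting `μ_q`, `I_𝔓` fixing `E[q]`); `K` a number field (the Heegner field); `g₂, σ₁ ∈ Γ_K` fixing
`E_K[q]`, with `res g₂ = F²` (a Frobenius of `K_λ`, `λ ∣ ℓ` inert) and `res σ₁ ∈ I_𝔓` (a lift of the inertial generator `τ₁` of
`Gal(K_{m,λ_m}/K_λ)`).  If the restriction of `x ∈ H¹(ℚ, E[q])` over `K` has **`[res x, g₂]_K ∈ ℤ·[res x, σ₁]_K`** — the output of
`exists_h1Eval_kolyvaginClass_eq_zsmul` when `res x` is the Kolyvagin class `c_M(m)` of a product `m` through the own prime `ℓ` (of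
index `≥ M+1`: hypotheses `hcyc`, `hQ` there) — then **`x` is HALF-TRANSVERSE at `F`**, the input (iii) of the deep-own-prime term
(`…HalfTransverseLocalPackaged`, `…RTDeepOwnPrimeCondition`). [cite: McCallumLMS1991, §4 Prop. 4.4 (1) and proof (p. 305)] -/
theorem halfTransverse_of_resTorsion_values {M q : ℕ} (hM : 2 ≤ M) (hq : q = 2 ^ M)
    (hqv : (q : 𝓞 ℚ) ∉ v.asIdeal)
    {𝔐 : Ideal (HeightOneSpectrum.localAbsIntegers v)} (h𝔐 : 𝔐 ∈ v.localPrimesAbove)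
    {F : absoluteGaloisGroup ℚ}
    (hFrob : IsArithFrobAt (𝓞 ℚ) F (v.primeBelow (closureEmb (K := ℚ) (v.adicCompletion ℚ)) 𝔐))
    (hFμ : ∀ ζ : AlgebraicClosure ℚ, ζ ^ q = 1 → F • ζ = ζ⁻¹)
    (hF : ∀ Q : geomTorsion W (q : ℤ), F • F • Q = Q)
    {P : geomTorsion W (q : ℤ)} (hPM : (2 : ℤ) ^ M • P = 0)
    (hgen : ∀ Q : geomTorsion W (q : ℤ), ∃ x y : ℤ, Q = x • P + y • F • P)
    (hfree : ∀ x y : ℤ, x • P + y • F • P = 0 → (2 : ℤ) ^ M ∣ x ∧ (2 : ℤ) ^ M ∣ y)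
    (hI : (v.primeBelow (closureEmb (K := ℚ) (v.adicCompletion ℚ)) 𝔐).inertia (absoluteGaloisGroup ℚ) ≤
      torsionFixing W (q : ℤ))
    {x : galH1Torsion W (q : ℤ)} {g₂ σ₁ : absoluteGaloisGroup K}
    (hg₂ : g₂ ∈ torsionFixing (W.baseChange K) (q : ℤ)) (hσ₁ : σ₁ ∈ torsionFixing (W.baseChange K) (q : ℤ))
    (hg₂F : resGal (K := ℚ) K g₂ = F * F)
    (hσ₁I : resGal (K := ℚ) K σ₁ ∈ (v.primeBelow (closureEmb (K := ℚ) (v.adicCompletion ℚ)) 𝔐).inertia (absoluteGaloisGroup ℚ))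
    (hval : ∃ k : ℤ, h1Eval (W.baseChange K) (q : ℤ) (resTorsion W K (q : ℤ) x) g₂ =
      k • h1Eval (W.baseChange K) (q : ℤ) (resTorsion W K (q : ℤ) x) σ₁) :
    ∃ P₁ Q₁ : geomTorsion W (q : ℤ), h1Eval W (q : ℤ) x F = (F • P₁ - P₁) + (2 : ℕ) • Q₁ := by
  have hk := exists_h1Eval_resGal_eq_zsmul_of_resTorsion W K (q : ℤ) x hg₂ hσ₁ hval
  rw [hg₂F] at hk
  exact halfTransverse_of_h1Eval_sq_eq_zsmul_tame W hM hq hqv h𝔐 hFrob hFμ hF hPM hgen hfree hI hσ₁I hk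

/-- **(iii)-SOCKET, `∀𝔓 ∀F ∀c₀` packaging on `Δ < 0`** — the exact hypothesis shape `hx` of `…RTHalfTransverseIsotropicPackaged` (and, via
`transverse_nsmul_of_halfTransverse`, of `…RTDeepOwnPrimeCondition.exists_localCondition_eight_le_forall`): `E/ℚ` with `Δ < 0`, `M ≥ 2`,
`ℓ` an odd good prime at `v` (no depth hypothesis is needed here: the quantifier supplies `F = c₀` on `E[2^M]`); for EVERY prime `𝔓 ∣ v`,
Frobenius `F` at `𝔓` and complex conjugation `c₀` with
`F = c₀` on `E[2^M]`, the caller supplies (from the Kolyvagin-class structure over `K` at `λ ∣ ℓ`) elements `g₂, σ₁ ∈ Γ_{K(E_K[2^M])}`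
with `res g₂ = F²`, `res σ₁ ∈ I_𝔓` and `[res x, g₂]_K ∈ ℤ·[res x, σ₁]_K`; then `x` is half-transverse at every such `F`.
[cite: McCallumLMS1991, §4 Prop. 4.4 (1)] [cite: GrossLMS1991, §3 (3.2)–(3.3)] -/
theorem halfTransverse_forall_of_resTorsion_values (hΔ : W.Δ < 0) {M : ℕ} (hM : 2 ≤ M)
    {ℓ : ℕ} (hℓ : ℓ.Prime) (hℓ2 : ℓ ≠ 2) (hℓv : (ℓ : 𝓞 ℚ) ∈ v.asIdeal) (hgood : W.HasGoodReductionAt v)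
    {x : galH1Torsion W ((2 ^ M : ℕ) : ℤ)}
    (hval : ∀ 𝔓 ∈ v.primesAbove, ∀ F c₀ : absoluteGaloisGroup ℚ, IsArithFrobAt (𝓞 ℚ) F 𝔓 →
      IsComplexConjugation (Rat.castHom ℝ) c₀ → (∀ P : geomTorsion W ((2 ^ M : ℕ) : ℤ), F • P = c₀ • P) →
      ∃ g₂ σ₁ : absoluteGaloisGroup K, g₂ ∈ torsionFixing (W.baseChange K) ((2 ^ M : ℕ) : ℤ) ∧
        σ₁ ∈ torsionFixing (W.baseChange K) ((2 ^ M : ℕ) : ℤ) ∧ resGal (K := ℚ) K g₂ = F * F ∧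
        resGal (K := ℚ) K σ₁ ∈ 𝔓.inertia (absoluteGaloisGroup ℚ) ∧
        ∃ k : ℤ, h1Eval (W.baseChange K) _ (resTorsion W K _ x) g₂ = k • h1Eval (W.baseChange K) _ (resTorsion W K _ x) σ₁) :
    ∀ 𝔓 ∈ v.primesAbove, ∀ F c₀ : absoluteGaloisGroup ℚ, IsArithFrobAt (𝓞 ℚ) F 𝔓 →
      IsComplexConjugation (Rat.castHom ℝ) c₀ → (∀ P : geomTorsion W ((2 ^ M : ℕ) : ℤ), F • P = c₀ • P) →
      ∃ P₁ Q₁ : geomTorsion W ((2 ^ M : ℕ) : ℤ), h1Eval W _ x F = (F • P₁ - P₁) + (2 : ℕ) • Q₁ := by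
  intro 𝔓 h𝔓 F c₀ hFrob hc₀ hE
  haveI : 𝔓.IsPrime := h𝔓.1
  have hM1 : 1 ≤ M := by omega
  -- `2, q ∉ v`; regular generator
  have h2v : ((2 : ℕ) : 𝓞 ℚ) ∉ v.asIdeal := two_notMem_of_odd_prime_mem hℓ hℓ2 hℓv
  have hqv' : ((2 ^ M : ℕ) : 𝓞 ℚ) ∉ v.asIdeal := by
    rw [Nat.cast_pow]
    exact fun h ↦ h2v (v.isPrime.mem_of_pow_mem M h)
  have hqv : ((((2 ^ M : ℕ) : ℤ)) : 𝓞 ℚ) ∉ v.asIdeal := by rwa [Int.cast_natCast]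
  have hwbad : v ∉ W.badPlaces (𝓞 ℚ) := fun h ↦ h hgood
  obtain ⟨P, hPM, hgen, hfree⟩ := exists_regular_generator_of_Δ_neg W hΔ hc₀ hM1
  have hgenF : ∀ Q : geomTorsion W ((2 ^ M : ℕ) : ℤ), ∃ x y : ℤ, Q = x • P + y • F • P := by
    intro Q; rw [hE P]; exact hgen Q
  have hfreeF : ∀ x y : ℤ, x • P + y • F • P = 0 → (2 : ℤ) ^ M ∣ x ∧ (2 : ℤ) ^ M ∣ y := by
    intro x y h; rw [hE P] at h; exact hfree x y h
  have hF : ∀ Q : geomTorsion W ((2 ^ M : ℕ) : ℤ), F • F • Q = Q := fun Q ↦ by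
    rw [hE, hE, ← mul_smul, ← pow_two, hc₀.sq_eq_one, one_smul]
  have hFμ : ∀ ζ : AlgebraicClosure ℚ, ζ ^ (2 ^ M) = 1 → F • ζ = ζ⁻¹ := fun ζ hζ ↦
    smul_eq_inv_of_smul_torsion_pow_eq W Nat.prime_two hM1 rfl hc₀ hE hζ
  -- argue directly at `𝔓` (tame anti-invariance `smul_h1Eval_eq_neg_of_mem_inertia` holds at any prime above `v`)
  obtain ⟨g₂, σ₁, hg₂, hσ₁, hg₂F, hσ₁I, hk⟩ := hval 𝔓 h𝔓 F c₀ hFrob hc₀ hE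
  have hF𝔓 : F • 𝔓 = 𝔓 := MulAction.mem_stabilizer_iff.mp hFrob.mem_stabilizer
  have hI : 𝔓.inertia (absoluteGaloisGroup ℚ) ≤ torsionFixing W ((2 ^ M : ℕ) : ℤ) :=
    inertia_le_torsionFixing_of_hasGoodReductionAt W v hgood hqv h𝔓
  have ht : F • h1Eval W _ x (resGal (K := ℚ) K σ₁) = -h1Eval W _ x (resGal (K := ℚ) K σ₁) :=
    smul_h1Eval_eq_neg_of_mem_inertia W Nat.prime_two rfl hqv' h𝔓 hF𝔓 hFμ hI x hσ₁I
  have hk' := exists_h1Eval_resGal_eq_zsmul_of_resTorsion W K _ x hg₂ hσ₁ hk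
  rw [hg₂F] at hk'
  exact halfTransverse_of_h1Eval_sq_eq_zsmul_of_smul_eq_neg W hM hF hPM hgenF hfreeF ht hk'

end Socket

/-! ## §4 (appended) Robustness in the choice of the Frobenius over `K`: `res g₂ = F²·i` with `i` inertial -/

section SocketInertia

variable {v : HeightOneSpectrum (𝓞 ℚ)} (W : WeierstrassCurve ℚ) [W.IsElliptic] (K : Type) [Field K] [NumberField K]

/-- **(iii)-SOCKET, any Frobenius lift over `K`.**  As `halfTransverse_of_resTorsion_values`, but the `K`-element `g₂` at which the line
relation is known need only satisfy **`res g₂ = F²·i` for SOME `i ∈ I_𝔓`** (two arithmetic Frobenii of `K_λ` differ by inertia; the datum of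
`…RTOwnPrimeValuesOfDatum` may be built at ANY of them): `[x, F²·i] = [x, F²] + F²·[x, i] = [x, F²] + [x, i]` and the tame value `[x, i]` is
anti-invariant, so `[x, F²]` is anti-invariant and `halfTransverse_of_h1Eval_sq_smul_eq_neg` applies. [cite: McCallumLMS1991, §4 Prop. 4.4 (1)]
[cite: GrossLMS1991, §3 (3.3)] -/
theorem halfTransverse_of_resTorsion_values_of_eq_mul_inertia {M q : ℕ} (hM : 2 ≤ M) (hq : q = 2 ^ M)
    (hqv : (q : 𝓞 ℚ) ∉ v.asIdeal)
    {𝔐 : Ideal (HeightOneSpectrum.localAbsIntegers v)} (h𝔐 : 𝔐 ∈ v.localPrimesAbove)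
    {F : absoluteGaloisGroup ℚ}
    (hFrob : IsArithFrobAt (𝓞 ℚ) F (v.primeBelow (closureEmb (K := ℚ) (v.adicCompletion ℚ)) 𝔐))
    (hFμ : ∀ ζ : AlgebraicClosure ℚ, ζ ^ q = 1 → F • ζ = ζ⁻¹)
    (hF : ∀ Q : geomTorsion W (q : ℤ), F • F • Q = Q)
    {P : geomTorsion W (q : ℤ)} (hPM : (2 : ℤ) ^ M • P = 0)
    (hgen : ∀ Q : geomTorsion W (q : ℤ), ∃ x y : ℤ, Q = x • P + y • F • P)
    (hfree : ∀ x y : ℤ, x • P + y • F • P = 0 → (2 : ℤ) ^ M ∣ x ∧ (2 : ℤ) ^ M ∣ y)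
    (hI : (v.primeBelow (closureEmb (K := ℚ) (v.adicCompletion ℚ)) 𝔐).inertia (absoluteGaloisGroup ℚ) ≤
      torsionFixing W (q : ℤ))
    {x : galH1Torsion W (q : ℤ)} {g₂ σ₁ : absoluteGaloisGroup K}
    (hg₂ : g₂ ∈ torsionFixing (W.baseChange K) (q : ℤ)) (hσ₁ : σ₁ ∈ torsionFixing (W.baseChange K) (q : ℤ))
    {i : absoluteGaloisGroup ℚ}
    (hi : i ∈ (v.primeBelow (closureEmb (K := ℚ) (v.adicCompletion ℚ)) 𝔐).inertia (absoluteGaloisGroup ℚ))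
    (hg₂F : resGal (K := ℚ) K g₂ = F * F * i)
    (hσ₁I : resGal (K := ℚ) K σ₁ ∈ (v.primeBelow (closureEmb (K := ℚ) (v.adicCompletion ℚ)) 𝔐).inertia (absoluteGaloisGroup ℚ))
    (hval : ∃ k : ℤ, h1Eval (W.baseChange K) (q : ℤ) (resTorsion W K (q : ℤ) x) g₂ =
      k • h1Eval (W.baseChange K) (q : ℤ) (resTorsion W K (q : ℤ) x) σ₁) :
    ∃ P₁ Q₁ : geomTorsion W (q : ℤ), h1Eval W (q : ℤ) x F = (F • P₁ - P₁) + (2 : ℕ) • Q₁ := by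
  set 𝔓 := v.primeBelow (closureEmb (K := ℚ) (v.adicCompletion ℚ)) 𝔐 with h𝔓def
  have h𝔓 : 𝔓 ∈ v.primesAbove := HeightOneSpectrum.primeBelow_mem_primesAbove h𝔐
  haveI : 𝔓.IsPrime := h𝔓.1
  have hF𝔓 : F • 𝔓 = 𝔓 := MulAction.mem_stabilizer_iff.mp hFrob.mem_stabilizer
  obtain ⟨k, hk⟩ := exists_h1Eval_resGal_eq_zsmul_of_resTorsion W K (q : ℤ) x hg₂ hσ₁ hval
  rw [hg₂F, h1Eval_mul_smul, mul_smul, hF] at hk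
  -- `[x, F²] = k[x, res σ₁] - [x, i]`, both anti-invariant
  have hσ : F • h1Eval W (q : ℤ) x (resGal (K := ℚ) K σ₁) = -h1Eval W (q : ℤ) x (resGal (K := ℚ) K σ₁) :=
    smul_h1Eval_eq_neg_of_mem_inertia W Nat.prime_two hq hqv h𝔓 hF𝔓 hFμ hI x hσ₁I
  have hi' : F • h1Eval W (q : ℤ) x i = -h1Eval W (q : ℤ) x i :=
    smul_h1Eval_eq_neg_of_mem_inertia W Nat.prime_two hq hqv h𝔓 hF𝔓 hFμ hI x hi
  have hFF : h1Eval W (q : ℤ) x (F * F) = k • h1Eval W (q : ℤ) x (resGal (K := ℚ) K σ₁) - h1Eval W (q : ℤ) x i :=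
    eq_sub_of_add_eq hk
  have hPM' : ((2 : ℤ) ^ M) • P = 0 := hPM
  refine halfTransverse_of_h1Eval_sq_smul_eq_neg W hM hF hPM' hgen hfree ?_
  rw [hFF, smul_sub, smul_comm F k, hσ, hi', smul_neg]
  abel

end SocketInertia

end Summit.BirchSwinnertonDyer.BirchSwinnertonDyer.Theorems.GenusExact.TransverseIsotropy

end
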